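import Summits.Ventures.CertifiedManyBodySolver.Observables.SubGapResponseFluctuation
import Literature.MathematicalPhysics.QuantumLattice.DWaveSourceNNNHoppingOrderParameter
import Literature.MathematicalPhysics.QuantumLattice.DWaveKomaTasakiSystem
import Literature.MathematicalPhysics.QuantumLattice.GroundStateLocalCertificateKKT
import Literature.LinearAlgebra.Matrix.PosSemidefTrace
import HarnessLib

/-!
# Sub-gap response ≤ fluctuation: WINDOW forms and the `d`-wave torus instances (tree units)

Sequel of `SubGapResponseFluctuation.lean` (venture `CertifiedManyBodySolver`, `Observables/`; cell hubbard-cq,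
dictionary row «finite-volume KT-converse», transplant lens DICTIONARY v2 §9 / `TransplantSketch2.lean` A3, A4, A4′).

§1 (model-free). `H` with a unique gapped ground state (`Matrix.HasSpectralGap H g`), `O` Hermitian with
`Re ω_H(O) = 0`, `q := Re ω_H(O·O)`, `0 < h`, `2h‖O‖ < g`. WINDOW forms — the shape a certificate consumer
uses (no ground-state property of the state is assumed, only an energy window):
* `re_trace_mul_le_of_window_of_hasSpectralGap` (A3): every density matrix `ρ` (`ρ ⪰ 0`, `tr ρ = 1`) with
  `Re tr ρ(H − hO) ≤ E₀(H − hO) + δ` has `Re tr(ρO) ≤ δ/h + 4hq/(g − 2h‖O‖)`;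
* `re_rayleigh_le_of_window_of_hasSpectralGap`: the same for a unit vector with an energy cap (the
  hypothesis an energy row of a moment relaxation speaks about).

§2 (tree units, the sourced `t–t'` Hubbard torus `dWaveSourceTorusTT' L t' U μ h = H₀ − h·O`,
`H₀ = dWaveSourceTorusTT' L t' U μ 0 = H(1,t',U) − μN`, `O = Δ_d + Δ_d†`, `Δ_d = pairField dWaveFormFactor L`,
`Re ω_h(O) = 2L²·m_L(h)`, `m_L = dWaveSourceDensityTT'`; the symmetric point `Re ω_{H₀}(O) = 0` holds by
particle-number conservation, `dWaveSourceDensityTT'_source_zero`). Under a spectral gap `g` of the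
UNSOURCED grand-canonical torus matrix `H₀` (a total-energy, all-of-Fock-space quantity — door E1c of the
cell's census; no thermodynamic-limit content):
* `dWave_groundEnergy_sourced_ge_of_hasSpectralGap` (A1 instance, the T4-lane bracket): for `0 ≤ h`,
  `h‖O‖ < g`, `E₀(H₀) − h²·Re ω₀(O²)/(g − h‖O‖) ≤ E₀(H₀ − hO) (≤ E₀(H₀))` — a certified SOURCED-energy
  bracket from UNSOURCED certified data (`q`, `g`);
* `dWave_subGapResponse_le_fluctuation` (A4): `2L²·m_L(h) ≤ 4h·Re ω₀(O²)/(g − 2h‖O‖)` for `0 < h`,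
  `2h‖O‖ < g`, and the per-site form `dWaveSourceDensityTT'_le_fluctuation_of_hasSpectralGap`;
* `dWave_fluctuationFloor_of_responseFloor` (A4′, θ-form — the dictionary ROW): at the field
  `h = θg/(2‖O‖)`, `0 < θ < 1`, a response floor `m₀ ≤ m_L(h)` forces
  `m₀·(‖O‖/L²)·((1 − θ)/θ) ≤ Re ω₀(O²)/L⁴`;
* `dWave_re_trace_mul_le_of_window` (A3 instance): the window ceiling for every density matrix within `δ`
  of the sourced torus ground energy;
* the PAIR-FLUCTUATION reading of `q = Re ω₀(O·O)`: charge-`4` words vanish in the unsourced ground state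
  (`groundStateFunctional_pairField_mul_pairField_source_zero`, `ω₀(Δ_dΔ_d) = 0` by `N`-conservation), so
  `Re ω₀(O·O) = 2·Re ω₀(Δ_d†Δ_d) + Re ω₀([Δ_d, Δ_d†])` (`dWave_re_groundStateFunctional_opSq_eq`): the row
  bounds the `k = 0` pair structure factor `ω₀(Δ_d†Δ_d)` of the SYMMETRIC-point ground state from below by
  a sub-gap response floor, up to the bounded commutator term (`dWave_pairFluctuationFloor_of_responseFloor`).

No definition, no named fact, no `sorry`; zero compute. REUSED tree API: `dWaveSourceTorusTT'_eq`,
`dWaveSourceTorusTT'_zero_source`, `re_groundStateFunctional_dWaveSourceTT'_op`,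
`dWaveSourceDensityTT'_source_zero`, `isHermitian_pairField_add_conjTranspose`, `cast_sq_pos_of_neZero`,
`hubbardTorusTT'_commute_totalNumber`, `DWaveKT.pairField_mul_totalNumber` (KT94 (2.16)),
`groundStateFunctional_comm_eq_zero_of_commute`.
-/

noncomputable section

namespace Summit.Ventures.CertifiedManyBodySolver.Observables

open Matrix Literature.MathematicalPhysics.QuantumLattice Literature.Probability.LatticeModels
open scoped Matrix.Norms.L2Operator ComplexOrder

/-! ## §1 Window forms (model-free) -/

section ModelFree

variable {n : Type*} [Fintype n] [DecidableEq n]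

/-! ### A3: window forms (the shape a certificate consumer uses) -/

/-- **A3 — window form, density matrices.** Under `H.HasSpectralGap g`, `O` Hermitian,
`Re ω_H(O) = 0`, `q = Re ω_H(O·O)`, `0 < h`, `2h‖O‖ < g`: every density matrix `ρ` (`ρ ⪰ 0`,
`tr ρ = 1`) certified to lie within `δ` of the sourced ground energy,
`Re tr ρ(H − hO) ≤ E₀(H − hO) + δ`, has `Re tr(ρO) ≤ δ/h + 4hq/(g − 2h‖O‖)`
(variational principle for `ρ` at the source `2h`, `E₀(H − hO) ≤ E₀(H)`, and A1 at `2h`). [folklore] -/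
theorem re_trace_mul_le_of_window_of_hasSpectralGap {H O ρ : Matrix n n ℂ} {g h δ : ℝ}
    (hgap : H.HasSpectralGap g) (hO : O.IsHermitian) (h0 : (H.groundStateFunctional O).re = 0)
    (hh : 0 < h) (hhg : 2 * h * ‖O‖ < g) (hρ : ρ.PosSemidef) (hρ1 : ρ.trace = 1)
    (hwin : (ρ * (H - (h : ℂ) • O)).trace.re ≤ (H - (h : ℂ) • O).groundEnergy + δ) :
    (ρ * O).trace.re ≤ δ / h + 4 * h * (H.groundStateFunctional (O * O)).re / (g - 2 * h * ‖O‖) := by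
  haveI : Nonempty n := nonempty_of_hasSpectralGap hgap
  have hH : H.IsHermitian := hgap.isHermitian
  have hB : (H - ((2 * h : ℝ) : ℂ) • O).IsHermitian := isHermitian_sub_real_smul hH hO (2 * h)
  -- variational principle for the density matrix `ρ` and the Hermitian `H − 2hO`
  have hvar : (H - ((2 * h : ℝ) : ℂ) • O).groundEnergy ≤
      (ρ * (H - ((2 * h : ℝ) : ℂ) • O)).trace.re := by
    have hK : ((H - ((2 * h : ℝ) : ℂ) • O) -
        ((H - ((2 * h : ℝ) : ℂ) • O).groundEnergy : ℂ) • (1 : Matrix n n ℂ)).PosSemidef := by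
      have hK' := posSemidef_sub_groundEnergy hB
      rwa [Algebra.algebraMap_eq_smul_one, ← Complex.coe_smul] at hK'
    have h1 := Literature.LinearAlgebra.Matrix.re_trace_mul_nonneg_of_posSemidef hρ hK
    rw [mul_sub, trace_sub, Matrix.mul_smul, mul_one, trace_smul, smul_eq_mul, hρ1, mul_one,
      Complex.sub_re, Complex.ofReal_re] at h1
    linarith
  -- `Re tr ρ(H − 2hO) = Re tr ρ(H − hO) − h·Re tr(ρO)`
  have hsplit : (ρ * (H - ((2 * h : ℝ) : ℂ) • O)).trace.re =
      (ρ * (H - (h : ℂ) • O)).trace.re - h * (ρ * O).trace.re := by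
    have h2 : ((2 * h : ℝ) : ℂ) • O = (h : ℂ) • O + (h : ℂ) • O := by
      rw [← add_smul, Complex.ofReal_mul, Complex.ofReal_ofNat, two_mul]
    rw [h2, sub_add_eq_sub_sub, mul_sub, trace_sub, Matrix.mul_smul, trace_smul, smul_eq_mul,
      Complex.sub_re, Complex.re_ofReal_mul]
  have hup : (H - (h : ℂ) • O).groundEnergy ≤ H.groundEnergy :=
    groundEnergy_source_le_of_re_eq_zero hH hO h0 h
  have hA1 := groundEnergy_sub_le_groundEnergy_source_of_hasSpectralGap hgap hO h0
    (show (0 : ℝ) ≤ 2 * h by linarith) hhg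
  have hg : 0 < g - 2 * h * ‖O‖ := sub_pos.2 hhg
  -- `h·Re tr(ρO) ≤ δ + (2h)²q/(g − 2h‖O‖)`
  have hmain : h * (ρ * O).trace.re ≤
      δ + (2 * h) ^ 2 * (H.groundStateFunctional (O * O)).re / (g - 2 * h * ‖O‖) := by
    linarith [hvar, hsplit.symm.le, hsplit.le]
  rw [show δ / h + 4 * h * (H.groundStateFunctional (O * O)).re / (g - 2 * h * ‖O‖) =
      (δ + (2 * h) ^ 2 * (H.groundStateFunctional (O * O)).re / (g - 2 * h * ‖O‖)) / h by
    field_simp; ring]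
  rw [le_div_iff₀ hh]
  linarith

/-- **A3 — window form, state vectors** (the hypothesis an energy row of a relaxation speaks about):
a unit vector `ψ` with `Re⟨ψ,(H − hO)ψ⟩ ≤ E₀(H − hO) + δ` has
`Re⟨ψ, Oψ⟩ ≤ δ/h + 4hq/(g − 2h‖O‖)`. [folklore] -/
theorem re_rayleigh_le_of_window_of_hasSpectralGap {H O : Matrix n n ℂ} {g h δ : ℝ} {ψ : n → ℂ}
    (hgap : H.HasSpectralGap g) (hO : O.IsHermitian) (h0 : (H.groundStateFunctional O).re = 0)
    (hh : 0 < h) (hhg : 2 * h * ‖O‖ < g) (hψ : star ψ ⬝ᵥ ψ = 1)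
    (hwin : (star ψ ⬝ᵥ (H - (h : ℂ) • O) *ᵥ ψ).re ≤ (H - (h : ℂ) • O).groundEnergy + δ) :
    (star ψ ⬝ᵥ O *ᵥ ψ).re ≤ δ / h + 4 * h * (H.groundStateFunctional (O * O)).re / (g - 2 * h * ‖O‖) := by
  haveI : Nonempty n := nonempty_of_hasSpectralGap hgap
  have hH : H.IsHermitian := hgap.isHermitian
  -- Griffiths' vector inequality at the source `2h` with trial state `ψ`
  have hvar := groundEnergy_source_le_re_rayleigh_sub hH hO hψ h (2 * h)
  have hup : (H - (h : ℂ) • O).groundEnergy ≤ H.groundEnergy :=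
    groundEnergy_source_le_of_re_eq_zero hH hO h0 h
  have hA1 := groundEnergy_sub_le_groundEnergy_source_of_hasSpectralGap hgap hO h0
    (show (0 : ℝ) ≤ 2 * h by linarith) hhg
  have hg : 0 < g - 2 * h * ‖O‖ := sub_pos.2 hhg
  have hmain : h * (star ψ ⬝ᵥ O *ᵥ ψ).re ≤
      δ + (2 * h) ^ 2 * (H.groundStateFunctional (O * O)).re / (g - 2 * h * ‖O‖) := by
    have h2 : (2 * h - h) * (star ψ ⬝ᵥ O *ᵥ ψ).re = h * (star ψ ⬝ᵥ O *ᵥ ψ).re := by ring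
    linarith
  rw [show δ / h + 4 * h * (H.groundStateFunctional (O * O)).re / (g - 2 * h * ‖O‖) =
      (δ + (2 * h) ^ 2 * (H.groundStateFunctional (O * O)).re / (g - 2 * h * ‖O‖)) / h by
    field_simp; ring]
  rw [le_div_iff₀ hh]
  linarith


end ModelFree

/-! ## §2 The `d`-wave torus instances (tree units) -/

section DWave

variable (L : ℕ) [NeZero L]

/-- `H_{L,h} = H₀ − h·O` with `H₀ = dWaveSourceTorusTT' L t' U μ 0` the UNSOURCED grand-canonical `t–t'`
torus and `O = Δ_d + Δ_d†` (definitional bookkeeping, `dWaveSourceTorusTT'_eq` and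
`dWaveSourceTorusTT'_zero_source`). -/
theorem dWaveSourceTorusTT'_eq_zero_source_sub (t' U μ h : ℝ) :
    dWaveSourceTorusTT' L t' U μ h = dWaveSourceTorusTT' L t' U μ 0 -
      (h : ℂ) • (pairField dWaveFormFactor L + (pairField dWaveFormFactor L)ᴴ) := by
  rw [dWaveSourceTorusTT'_eq, dWaveSourceTorusTT'_zero_source]

/-- **The symmetric point**: `Re ω_{H₀}(Δ_d + Δ_d†) = 0` for the unsourced torus (particle-number
conservation; `dWaveSourceDensityTT'_source_zero`). -/
theorem re_groundStateFunctional_dWaveSourceTT'_op_source_zero (t' U μ : ℝ) :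
    ((dWaveSourceTorusTT' L t' U μ 0).groundStateFunctional
        (pairField dWaveFormFactor L + (pairField dWaveFormFactor L)ᴴ)).re = 0 := by
  rw [re_groundStateFunctional_dWaveSourceTT'_op, dWaveSourceDensityTT'_source_zero, mul_zero]

variable {L}

/-- **A1 instance — certified SOURCED-energy floor from UNSOURCED data (T4 lane).** If the unsourced
grand-canonical `t–t'` torus `H₀ = dWaveSourceTorusTT' L t' U μ 0` has a unique ground state with spectral
gap `g`, then for `0 ≤ h` with `h‖O‖ < g`, `O = Δ_d + Δ_d†`:
`E₀(H₀) − h²·Re ω₀(O·O)/(g − h‖O‖) ≤ E₀(dWaveSourceTorusTT' L t' U μ h)`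
(the matching ceiling `E₀(H_{L,h}) ≤ E₀(H₀)` is `groundEnergy_dWaveSourceTorusTT'_le`). -/
theorem dWave_groundEnergy_sourced_ge_of_hasSpectralGap (t' U μ : ℝ) {g h : ℝ}
    (hgap : (dWaveSourceTorusTT' L t' U μ 0).HasSpectralGap g) (hh : 0 ≤ h)
    (hhg : h * ‖pairField dWaveFormFactor L + (pairField dWaveFormFactor L)ᴴ‖ < g) :
    (dWaveSourceTorusTT' L t' U μ 0).groundEnergy -
        h ^ 2 * ((dWaveSourceTorusTT' L t' U μ 0).groundStateFunctional
          ((pairField dWaveFormFactor L + (pairField dWaveFormFactor L)ᴴ) *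
            (pairField dWaveFormFactor L + (pairField dWaveFormFactor L)ᴴ))).re /
          (g - h * ‖pairField dWaveFormFactor L + (pairField dWaveFormFactor L)ᴴ‖) ≤
      (dWaveSourceTorusTT' L t' U μ h).groundEnergy := by
  rw [dWaveSourceTorusTT'_eq_zero_source_sub L t' U μ h]
  exact groundEnergy_sub_le_groundEnergy_source_of_hasSpectralGap hgap
    (isHermitian_pairField_add_conjTranspose L)
    (re_groundStateFunctional_dWaveSourceTT'_op_source_zero L t' U μ) hh hhg

/-- **A4 — sub-gap `d`-wave response ≤ pair fluctuation (tree units).** Under a spectral gap `g` of the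
unsourced torus `H₀`, for `0 < h` with `2h‖O‖ < g`:
`2L²·m_L(h) ≤ 4h·Re ω₀(O·O)/(g − 2h‖O‖)`, `m_L(h) = dWaveSourceDensityTT' L t' U μ h`, `O = Δ_d + Δ_d†`. -/
theorem dWave_subGapResponse_le_fluctuation (t' U μ : ℝ) {g h : ℝ}
    (hgap : (dWaveSourceTorusTT' L t' U μ 0).HasSpectralGap g) (hh : 0 < h)
    (hhg : 2 * h * ‖pairField dWaveFormFactor L + (pairField dWaveFormFactor L)ᴴ‖ < g) :
    2 * (L : ℝ) ^ 2 * dWaveSourceDensityTT' L t' U μ h ≤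
      4 * h * ((dWaveSourceTorusTT' L t' U μ 0).groundStateFunctional
          ((pairField dWaveFormFactor L + (pairField dWaveFormFactor L)ᴴ) *
            (pairField dWaveFormFactor L + (pairField dWaveFormFactor L)ᴴ))).re /
        (g - 2 * h * ‖pairField dWaveFormFactor L + (pairField dWaveFormFactor L)ᴴ‖) := by
  have key := re_groundStateFunctional_source_le_fluctuation hgap
    (isHermitian_pairField_add_conjTranspose L)
    (re_groundStateFunctional_dWaveSourceTT'_op_source_zero L t' U μ) hh hhg
  rwa [← dWaveSourceTorusTT'_eq_zero_source_sub L t' U μ h,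
    re_groundStateFunctional_dWaveSourceTT'_op] at key

/-- Per-site form of A4: `m_L(h) ≤ 2h·Re ω₀(O·O)/((g − 2h‖O‖)·L²)`. -/
theorem dWaveSourceDensityTT'_le_fluctuation_of_hasSpectralGap (t' U μ : ℝ) {g h : ℝ}
    (hgap : (dWaveSourceTorusTT' L t' U μ 0).HasSpectralGap g) (hh : 0 < h)
    (hhg : 2 * h * ‖pairField dWaveFormFactor L + (pairField dWaveFormFactor L)ᴴ‖ < g) :
    dWaveSourceDensityTT' L t' U μ h ≤
      2 * h * ((dWaveSourceTorusTT' L t' U μ 0).groundStateFunctional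
          ((pairField dWaveFormFactor L + (pairField dWaveFormFactor L)ᴴ) *
            (pairField dWaveFormFactor L + (pairField dWaveFormFactor L)ᴴ))).re /
        ((g - 2 * h * ‖pairField dWaveFormFactor L + (pairField dWaveFormFactor L)ᴴ‖) * (L : ℝ) ^ 2) := by
  have key := dWave_subGapResponse_le_fluctuation t' U μ hgap hh hhg
  have hL : (0 : ℝ) < (L : ℝ) ^ 2 := cast_sq_pos_of_neZero L
  have hg : 0 < g - 2 * h * ‖pairField dWaveFormFactor L + (pairField dWaveFormFactor L)ᴴ‖ :=
    sub_pos.2 hhg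
  rw [le_div_iff₀ (mul_pos hg hL)]
  rw [le_div_iff₀ hg] at key
  nlinarith [key]

/-- **A4′ — the dictionary ROW (θ-form): a response floor at one sub-gap field forces a pair-fluctuation
floor at the symmetric point.** Under a spectral gap `g` of the unsourced torus `H₀` and `‖O‖ > 0`,
`O = Δ_d + Δ_d†`: at the field `h = θg/(2‖O‖)`, `0 < θ < 1`, a certified response floor
`m₀ ≤ m_L(h)` gives `m₀·(‖O‖/L²)·((1 − θ)/θ) ≤ Re ω₀(O·O)/L⁴`. -/
theorem dWave_fluctuationFloor_of_responseFloor (t' U μ : ℝ) {g θ m₀ : ℝ}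
    (hgap : (dWaveSourceTorusTT' L t' U μ 0).HasSpectralGap g) (hθ : 0 < θ) (hθ1 : θ < 1)
    (hO : 0 < ‖pairField dWaveFormFactor L + (pairField dWaveFormFactor L)ᴴ‖)
    (hm : m₀ ≤ dWaveSourceDensityTT' L t' U μ
      (θ * g / (2 * ‖pairField dWaveFormFactor L + (pairField dWaveFormFactor L)ᴴ‖))) :
    m₀ * (‖pairField dWaveFormFactor L + (pairField dWaveFormFactor L)ᴴ‖ / (L : ℝ) ^ 2) *
        ((1 - θ) / θ) ≤
      ((dWaveSourceTorusTT' L t' U μ 0).groundStateFunctional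
          ((pairField dWaveFormFactor L + (pairField dWaveFormFactor L)ᴴ) *
            (pairField dWaveFormFactor L + (pairField dWaveFormFactor L)ᴴ))).re / (L : ℝ) ^ 4 := by
  set nO : ℝ := ‖pairField dWaveFormFactor L + (pairField dWaveFormFactor L)ᴴ‖ with hnO
  set q : ℝ := ((dWaveSourceTorusTT' L t' U μ 0).groundStateFunctional
      ((pairField dWaveFormFactor L + (pairField dWaveFormFactor L)ᴴ) *
        (pairField dWaveFormFactor L + (pairField dWaveFormFactor L)ᴴ))).re with hq
  have hgpos : 0 < g := pos_of_hasSpectralGap hgap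
  have hL : (0 : ℝ) < (L : ℝ) ^ 2 := cast_sq_pos_of_neZero L
  set h : ℝ := θ * g / (2 * nO) with hh_def
  have hh : 0 < h := by rw [hh_def]; positivity
  have h2h : 2 * h * nO = θ * g := by rw [hh_def]; field_simp
  have hhg : 2 * h * nO < g := by rw [h2h]; nlinarith
  have key := dWave_subGapResponse_le_fluctuation t' U μ hgap hh hhg
  rw [← hq, ← hnO, h2h] at key
  -- `4hq/(g − θg) = 2θq/(nO(1 − θ))`
  have hden : 0 < g - θ * g := by nlinarith
  have hA : 4 * h * q / (g - θ * g) = 2 * θ * q / (nO * (1 - θ)) := by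
    rw [hh_def]
    field_simp
    ring
  rw [hA] at key
  have hm' : 2 * (L : ℝ) ^ 2 * m₀ ≤ 2 * θ * q / (nO * (1 - θ)) :=
    (mul_le_mul_of_nonneg_left hm (by positivity)).trans key
  have h1θ : 0 < 1 - θ := by linarith
  have hm'' : m₀ ≤ 2 * θ * q / (nO * (1 - θ)) / (2 * (L : ℝ) ^ 2) := by
    rw [le_div_iff₀ (by positivity)]
    linarith
  calc m₀ * (nO / (L : ℝ) ^ 2) * ((1 - θ) / θ)
      ≤ 2 * θ * q / (nO * (1 - θ)) / (2 * (L : ℝ) ^ 2) * (nO / (L : ℝ) ^ 2) * ((1 - θ) / θ) := by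
        gcongr
    _ = q / (L : ℝ) ^ 4 := by
        field_simp

/-- **A3 instance — window ceiling on the sourced torus.** Under a spectral gap `g` of the unsourced torus
`H₀`, for `0 < h` with `2h‖O‖ < g`: every density matrix `ρ` with
`Re tr ρ·H_{L,h} ≤ E₀(H_{L,h}) + δ` has `Re tr(ρ(Δ_d + Δ_d†)) ≤ δ/h + 4h·Re ω₀(O·O)/(g − 2h‖O‖)`. -/
theorem dWave_re_trace_mul_le_of_window (t' U μ : ℝ) {g h δ : ℝ}
    {ρ : Matrix (Finset (Orb (FermionTorus 2 L))) (Finset (Orb (FermionTorus 2 L))) ℂ}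
    (hgap : (dWaveSourceTorusTT' L t' U μ 0).HasSpectralGap g) (hh : 0 < h)
    (hhg : 2 * h * ‖pairField dWaveFormFactor L + (pairField dWaveFormFactor L)ᴴ‖ < g)
    (hρ : ρ.PosSemidef) (hρ1 : ρ.trace = 1)
    (hwin : (ρ * dWaveSourceTorusTT' L t' U μ h).trace.re ≤
      (dWaveSourceTorusTT' L t' U μ h).groundEnergy + δ) :
    (ρ * (pairField dWaveFormFactor L + (pairField dWaveFormFactor L)ᴴ)).trace.re ≤
      δ / h + 4 * h * ((dWaveSourceTorusTT' L t' U μ 0).groundStateFunctional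
          ((pairField dWaveFormFactor L + (pairField dWaveFormFactor L)ᴴ) *
            (pairField dWaveFormFactor L + (pairField dWaveFormFactor L)ᴴ))).re /
        (g - 2 * h * ‖pairField dWaveFormFactor L + (pairField dWaveFormFactor L)ᴴ‖) := by
  rw [dWaveSourceTorusTT'_eq_zero_source_sub L t' U μ h] at hwin
  exact re_trace_mul_le_of_window_of_hasSpectralGap hgap (isHermitian_pairField_add_conjTranspose L)
    (re_groundStateFunctional_dWaveSourceTT'_op_source_zero L t' U μ) hh hhg hρ hρ1 hwin

/-! ### The pair-fluctuation reading of `q = Re ω₀(O·O)` -/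

variable (L)

/-- The unsourced grand-canonical `t–t'` torus conserves the particle number. -/
theorem dWaveSourceTorusTT'_source_zero_commute_totalNumber (t' U μ : ℝ) :
    Commute (dWaveSourceTorusTT' L t' U μ 0) totalNumber := by
  rw [dWaveSourceTorusTT'_zero_source]
  exact (hubbardTorusTT'_commute_totalNumber L 1 t' U).sub_left ((Commute.refl _).smul_left _)

/-- **Charge-`4` words vanish at the symmetric point**: `ω₀(Δ_d Δ_d) = 0` in the tracial ground state of
the unsourced torus (`[N, Δ_dΔ_d] = −4Δ_dΔ_d` by KT94 (2.16), and conserved charges kill commutators). -/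
theorem groundStateFunctional_pairField_mul_pairField_source_zero (t' U μ : ℝ) :
    (dWaveSourceTorusTT' L t' U μ 0).groundStateFunctional
      (pairField dWaveFormFactor L * pairField dWaveFormFactor L) = 0 := by
  set Δ := pairField dWaveFormFactor L with hΔ
  have hH := dWaveSourceTorusTT'_isHermitian L t' U μ 0
  have hC := (dWaveSourceTorusTT'_source_zero_commute_totalNumber L t' U μ).symm.eq
  have h0 := groundStateFunctional_comm_eq_zero_of_commute hH hC (Δ * Δ)
  have h1 : Δ * totalNumber = totalNumber * Δ + (2 : ℂ) • Δ := DWaveKT.pairField_mul_totalNumber L _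
  have hcomm : totalNumber * (Δ * Δ) - Δ * Δ * totalNumber = (-4 : ℂ) • (Δ * Δ) := by
    have h2 : Δ * Δ * totalNumber = totalNumber * (Δ * Δ) + (4 : ℂ) • (Δ * Δ) := by
      calc Δ * Δ * totalNumber = Δ * (totalNumber * Δ + (2 : ℂ) • Δ) := by rw [Matrix.mul_assoc, h1]
        _ = (totalNumber * Δ + (2 : ℂ) • Δ) * Δ + (2 : ℂ) • (Δ * Δ) := by
            rw [Matrix.mul_add, Matrix.mul_smul, ← Matrix.mul_assoc, h1]
        _ = totalNumber * (Δ * Δ) + (4 : ℂ) • (Δ * Δ) := by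
            rw [Matrix.add_mul, Matrix.smul_mul, Matrix.mul_assoc, add_assoc, ← add_smul]
            norm_num
    rw [h2]
    module
  rw [hcomm, map_smul, smul_eq_mul, mul_eq_zero] at h0
  exact h0.resolve_left (by norm_num)

/-- **`q` is twice the `k = 0` pair structure factor up to a commutator**: with `O = Δ_d + Δ_d†`,
`Re ω₀(O·O) = 2·Re ω₀(Δ_d†Δ_d) + Re ω₀(Δ_dΔ_d† − Δ_d†Δ_d)` in the unsourced torus ground state
(`ω₀(Δ_dΔ_d) = ω₀(Δ_d†Δ_d†) = 0`). -/
theorem dWave_re_groundStateFunctional_opSq_eq (t' U μ : ℝ) :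
    ((dWaveSourceTorusTT' L t' U μ 0).groundStateFunctional
        ((pairField dWaveFormFactor L + (pairField dWaveFormFactor L)ᴴ) *
          (pairField dWaveFormFactor L + (pairField dWaveFormFactor L)ᴴ))).re =
      2 * ((dWaveSourceTorusTT' L t' U μ 0).groundStateFunctional
            ((pairField dWaveFormFactor L)ᴴ * pairField dWaveFormFactor L)).re +
        ((dWaveSourceTorusTT' L t' U μ 0).groundStateFunctional
            (pairField dWaveFormFactor L * (pairField dWaveFormFactor L)ᴴ -
              (pairField dWaveFormFactor L)ᴴ * pairField dWaveFormFactor L)).re := by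
  set Δ := pairField dWaveFormFactor L with hΔ
  set A := dWaveSourceTorusTT' L t' U μ 0 with hA
  have hsq : (Δ + Δᴴ) * (Δ + Δᴴ) = Δ * Δ + Δ * Δᴴ + Δᴴ * Δ + Δᴴ * Δᴴ := by
    rw [Matrix.add_mul, Matrix.mul_add, Matrix.mul_add]; abel
  have h1 : A.groundStateFunctional (Δ * Δ) = 0 :=
    groundStateFunctional_pairField_mul_pairField_source_zero L t' U μ
  have h2 : A.groundStateFunctional (Δᴴ * Δᴴ) = 0 := by
    rw [← conjTranspose_mul, groundStateFunctional_conjTranspose, h1, star_zero]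
  rw [hsq, map_add, map_add, map_add, h1, h2, map_sub]
  simp only [Complex.add_re, Complex.sub_re, Complex.zero_re]
  ring

variable {L}

/-- **A4′ in pair-structure-factor form (the dictionary ROW, tree units).** Under a spectral gap `g` of the
unsourced torus `H₀` and `‖O‖ > 0`: a response floor `m₀ ≤ m_L(θg/(2‖O‖))`, `0 < θ < 1`, forces
`m₀·(‖O‖/L²)·((1 − θ)/θ) − Re ω₀([Δ_d, Δ_d†])/L⁴ ≤ 2·Re ω₀(Δ_d†Δ_d)/L⁴`
— a FLOOR on the `k = 0` pair fluctuation of the SYMMETRIC-point ground state (the commutator term is a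
bounded, `O(L²)`-norm correction). -/
theorem dWave_pairFluctuationFloor_of_responseFloor (t' U μ : ℝ) {g θ m₀ : ℝ}
    (hgap : (dWaveSourceTorusTT' L t' U μ 0).HasSpectralGap g) (hθ : 0 < θ) (hθ1 : θ < 1)
    (hO : 0 < ‖pairField dWaveFormFactor L + (pairField dWaveFormFactor L)ᴴ‖)
    (hm : m₀ ≤ dWaveSourceDensityTT' L t' U μ
      (θ * g / (2 * ‖pairField dWaveFormFactor L + (pairField dWaveFormFactor L)ᴴ‖))) :
    m₀ * (‖pairField dWaveFormFactor L + (pairField dWaveFormFactor L)ᴴ‖ / (L : ℝ) ^ 2) *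
          ((1 - θ) / θ) -
        ((dWaveSourceTorusTT' L t' U μ 0).groundStateFunctional
            (pairField dWaveFormFactor L * (pairField dWaveFormFactor L)ᴴ -
              (pairField dWaveFormFactor L)ᴴ * pairField dWaveFormFactor L)).re / (L : ℝ) ^ 4 ≤
      2 * ((dWaveSourceTorusTT' L t' U μ 0).groundStateFunctional
            ((pairField dWaveFormFactor L)ᴴ * pairField dWaveFormFactor L)).re / (L : ℝ) ^ 4 := by
  have key := dWave_fluctuationFloor_of_responseFloor t' U μ hgap hθ hθ1 hO hm
  rw [dWave_re_groundStateFunctional_opSq_eq L t' U μ, add_div] at key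
  linarith

end DWave

end Summit.Ventures.CertifiedManyBodySolver.Observables

end
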